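import Summits.AtomisticToContinuum.FouriersLaw.Cruxes.AbelThermodynamicLimit.SketchIdeator3

/-!
# Triage probe (crux-triage r1, triager 3): the typed `LateSlipBound` of card
`exit-ledger-slip-bound` is implied by the companion card's remainder `UniformLateFlatness`
with the comparison constant `C := 0` — so, AS TYPED, the "late global-Ohm bound" is not a
weaker intermediate than late flatness; the exit ledger / exit sign / sub-ballistic conjuncts
then do no logical work (they only serve to get flatness BACK from the slip bound).
-/

open Summit.AtomisticToContinuum.FouriersLaw.Cruxes.AbelThermodynamicLimit

theorem lateSlipBound_of_uniformLateFlatness (h : UniformLateFlatness) : LateSlipBound := by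
  intro ω₂ lam β γ hω hl hβ hγ T hT
  refine ⟨0, le_rfl, fun ε hε => ?_⟩
  obtain ⟨ν₀, hν₀, N₀, hN₀⟩ := h ω₂ lam β γ hω hl hβ hγ T hT (ε / 2) (half_pos hε)
  refine ⟨ν₀, hν₀, N₀, fun N hN ν ν' hν hνν' hν'₀ => ?_⟩
  rw [zero_mul, zero_add]
  have key : ∀ x : ℝ, 0 ≤ x → x ≤ ν₀ →
      |anchoredAbel ω₂ lam β γ T N 0 - anchoredAbel ω₂ lam β γ T N x| ≤ ε / 2 := by
    intro x hx0 hx1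
    rcases hx0.eq_or_lt with h0 | hxpos
    · rw [← h0, sub_self, abs_zero]; exact (half_pos hε).le
    · exact hN₀ N hN x hxpos hx1
  have h1 := key ν hν (le_trans hνν' hν'₀)
  have h2 := key ν' (le_trans hν hνν') hν'₀
  rw [show anchoredAbel ω₂ lam β γ T N ν - anchoredAbel ω₂ lam β γ T N ν' =
      (anchoredAbel ω₂ lam β γ T N 0 - anchoredAbel ω₂ lam β γ T N ν') -
        (anchoredAbel ω₂ lam β γ T N 0 - anchoredAbel ω₂ lam β γ T N ν) by ring]
  calc |(anchoredAbel ω₂ lam β γ T N 0 - anchoredAbel ω₂ lam β γ T N ν') -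
        (anchoredAbel ω₂ lam β γ T N 0 - anchoredAbel ω₂ lam β γ T N ν)|
      ≤ |anchoredAbel ω₂ lam β γ T N 0 - anchoredAbel ω₂ lam β γ T N ν'| +
        |anchoredAbel ω₂ lam β γ T N 0 - anchoredAbel ω₂ lam β γ T N ν| := abs_sub _ _
    _ ≤ ε / 2 + ε / 2 := add_le_add h2 h1
    _ = ε := by ring

/-- Converse bookkeeping already in the sketch: the slip bound gives flatness back only with four
more hypotheses. Together: modulo (AnchoredKubo, ExitLedger, ExitSign, SubBallistic) the slip
bound and late flatness are the same stub. -/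
example (hK : AnchoredKubo) (hX : ExitLedger) (hSig : ExitSign) (hβ : SubBallistic)
    (h : UniformLateFlatness) : LateFlatnessAlongResponses :=
  lateFlatness_of_exitLedger hK hX (lateSlipBound_of_uniformLateFlatness h) hSig hβ
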